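import Summits.HubbardSuperconductivity.HubbardSuperconductivity.Theorems.KLProgrammeKLRegimeFlowReadScaleZeroSunsetFarRows

/-!
# Route `KLProgramme`, crux K3 — engine-flow child (stmt-HubbardSuperconductivity-20437), stub (C) at `n = 0`, located item #22a «(C)-SCALE0-PT2»,
# the FAR-SITE supplier, design of record «TWO SHELLS» ((R215)/(R216)): THE FAR ROWS FROM A PER-FREQUENCY FAR-ℓ² BOUND (shell-agnostic interface)

Seat hubbard-kl-k3c5-p1 (g14; owner of #22a).  The jet envelope of `farRows_le_of_jets` is numerically vacuous (float passes j310305 / p1 g21 FAR-JETS-FLOOR);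
the far half is re-routed through TWO SHELLS — high frequencies by p1 g21's analytic-strip doors (`…ScaleZeroCovarianceStripDecay[Sample]`), low frequencies
by a kit-certified Plancherel complement.  Both shells deliver the SAME intermediate object: for each Matsubara frequency `ω_i` of the window, a bound
`Φ i` on the WEIGHTED FAR ℓ² of the finite-torus Fourier inverse of the spatial symbol,
`Σ_{u : 𝕋_L, ũ far} w_k(ũ)·‖(torusFourierInv Ψ_{ω_i})(u)‖² ≤ Φ i` (`ũ` = centred representative).  This file turns such a family into the reader's far rows,
with NO reference to how `Φ` is obtained:
* §1 `sum_normSq_gridCov_eq_of_torusFourierInv` — D7 + the time-grid Parseval, as an IDENTITY for every site pair: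
  `Σ_{j₁} ‖A(((j₁,x₁),σ),0)((p₀,σ),1))‖² = 4M·Σ_i ‖(1/β)·TFI_i(x₁ − x₀)‖²`;
* §2 **`farRows_le_of_l2Far`** — the reader's `hfar k` (same summand, same far condition `z_c ∉ disk`) with
  **`bFar k = 16·(1/β)·Σ_i Φ i`**, from Gram 16 on `A₂`, `‖A₃‖ = ‖A₁‖`, §1, and the re-indexing `x₁ ↦ u = x₁ − x₀`.
The β-uniform bound `(1/β)Σ_i Φ i ≤ B_k` is the shells' business (high: `Σ_i (50/|ω_i|)²·(ring sum of e^{−2κ_i‖z‖})`; low: `#{|ω_i| ≤ ω₁}·D_k`).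

No definitions; nothing here asserts (C), any stub of 20437, K3 or superconductivity.
References: BGM 2006 §2.3 (2.17)–(2.20), (2.80), §3 (3.2) [cite: BenfattoGiulianiMastropietro2006].
-/

noncomputable section

namespace Summit.HubbardSuperconductivity.HubbardSuperconductivity.Theorems.KLRegimeSplit

set_option linter.dupNamespace false -- summit = problem name (single-conjunct summit), D-0017

open Literature.MathematicalPhysics.QuantumLattice Literature.Probability.LatticeModels Literature.Analysis.FunctionSpaces
open Summit.HubbardSuperconductivity.HubbardSuperconductivity.Theorems.DispersionFlow
open Summit.HubbardSuperconductivity.HubbardSuperconductivity.Theorems.EngineV8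
open MeasureTheory Set Finset Complex UnitAddTorus Real GrassmannAlgebra Matrix
open scoped FourierTransform Nat ENNReal NNReal

variable {L M : ℕ} [NeZero L]

/-! ## §1 The time-ℓ² of a covariance row as a frequency sum of the torus Fourier inverse — an identity -/

/-- **`Σ_{j₁} ‖A(((j₁,x₁),σ),0)((p₀,σ),1))‖² = 4M·Σ_i ‖(1/β)·(torusFourierInv Ψ_{ω_i})(x₁ − x₀)‖²`** (bare frame, `0 < β`; every site pair,
on-site included): D7 (`gridCov_hubbardCovAboveCT_apply_eq_sum_freqTerm`, `freqTerm_eq_torusFourierInv_one`) and the time-grid Parseval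
(`sum_norm_sq_matsubaraSum_eq`). -/
theorem sum_normSq_gridCov_eq_of_torusFourierInv {β : ℝ} (hβ : 0 < β) (μ : ℝ) (p₀ : GridPoint L (2 * (2 * M))) (x₁ : TorusSite 2 L)
    (σ : Fin 2) :
    ∑ j₁ : Fin (2 * (2 * M)), ‖((hubbardGridSub L M β (2 * (2 * M))).transpose * hubbardCovAboveCT L M β μ 0 0 klE0 *
        hubbardGridSub L M β (2 * (2 * M))) (((j₁, x₁), σ), 0) ((p₀, σ), 1)‖ ^ 2 =
      ((2 * (2 * M) : ℕ) : ℝ) * ∑ i : MatsubaraIdx M, ‖((1 / β : ℝ) : ℂ) * torusFourierInv (fun kv : TorusSite 2 L =>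
        (fun y : Momentum => uvSymbolFn 1 klE0 (frameLevel μ 0 ((2 * π) • y)) (matsubaraFreq β M i))
          (WithLp.toLp 2 fun j => ((kv j).val : ℝ) / L)) (x₁ - p₀.2)‖ ^ 2 := by
  classical
  set cc : MatsubaraIdx M → ℂ := fun i => ((1 / β : ℝ) : ℂ) * torusFourierInv (fun kv : TorusSite 2 L =>
      (fun y : Momentum => uvSymbolFn 1 klE0 (frameLevel μ 0 ((2 * π) • y)) (matsubaraFreq β M i))
        (WithLp.toLp 2 fun j => ((kv j).val : ℝ) / L)) (x₁ - p₀.2) with hcc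
  have hentry : ∀ j₁ : Fin (2 * (2 * M)), ((hubbardGridSub L M β (2 * (2 * M))).transpose * hubbardCovAboveCT L M β μ 0 0 klE0 *
        hubbardGridSub L M β (2 * (2 * M))) (((j₁, x₁), σ), 0) ((p₀, σ), 1) =
      ∑ i : MatsubaraIdx M, cexp (I * ((matsubaraFreq β M i *
        (gridTime β (2 * (2 * M)) j₁ - gridTime β (2 * (2 * M)) p₀.1) : ℝ) : ℂ)) * cc i := by
    intro j₁
    rw [gridCov_hubbardCovAboveCT_apply_eq_sum_freqTerm hβ μ klE0 ((j₁, x₁) : GridPoint L (2 * (2 * M))) p₀ σ]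
    refine Finset.sum_congr rfl fun i _ => ?_
    rw [freqTerm_eq_torusFourierInv_one hβ, torusProj_valSub_eq_sub]
    simp only [hcc]
    ring
  simp_rw [hentry]
  exact sum_norm_sq_matsubaraSum_eq hβ cc p₀.1

/-! ## §2 The far rows from a per-frequency far-ℓ² family -/

/-- **THE FAR ROWS FROM A PER-FREQUENCY WEIGHTED FAR-ℓ² BOUND** (bare frame; `μ ∈ klWindowC`, `β ≥ klBetaMin`, `L ≥ klEngL₃ β U` for Gram 16): if for
every Matsubara frequency `ω_i` of the window the weighted far ℓ² of the torus Fourier inverse of the spatial symbol is `≤ Φ i`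
(far = centred representative outside the record's disk; weight `√(|ũ₀|²+|ũ₁|²)ᵏ`), then the reader's far row `k` is
`≤ (16·(1/β)·Σ_i Φ i)·(4M/β)`. -/
theorem farRows_le_of_l2Far [NeZero M] (c : SunsetCellRecordV2) {μ U β : ℝ} (hμ : μ ∈ klWindowC) (hβ : klBetaMin ≤ β) (hL : klEngL₃ β U ≤ L)
    (k : Fin 3) {Φ : MatsubaraIdx M → ℝ}
    (hΦ : ∀ i : MatsubaraIdx M, ∑ u : TorusSite 2 L,
      (if u ≠ 0 ∧ (fun j => (u j).valMinAbs : Site 2) ∉ c.disk then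
        Real.sqrt ((((u 0).valMinAbs.natAbs : ℝ)) ^ 2 + (((u 1).valMinAbs.natAbs : ℝ)) ^ 2) ^ (k : ℕ) *
          ‖torusFourierInv (fun kv : TorusSite 2 L =>
            (fun y : Momentum => uvSymbolFn 1 klE0 (frameLevel μ 0 ((2 * π) • y)) (matsubaraFreq β M i))
              (WithLp.toLp 2 fun j => ((kv j).val : ℝ) / L)) u‖ ^ 2
        else 0) ≤ Φ i)
    (σ : Fin 2) (p₀ : GridPoint L (2 * (2 * M))) :
    ∑ p₁ : GridPoint L (2 * (2 * M)),
      (if p₁.2 ≠ p₀.2 ∧ (fun j => ((p₁.2 - p₀.2) j).valMinAbs : Site 2) ∉ c.disk then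
        Real.sqrt ((((p₁.2 - p₀.2) 0).valMinAbs.natAbs : ℝ) ^ 2 + (((p₁.2 - p₀.2) 1).valMinAbs.natAbs : ℝ) ^ 2) ^ (k : ℕ) *
          ‖contr ℂ ((hubbardGridSub L M β (2 * (2 * M))).transpose * hubbardCovAboveCT L M β μ 0 0 klE0 *
                hubbardGridSub L M β (2 * (2 * M))) (((p₁, σ), 0) : GridLeg (GridPoint L (2 * (2 * M)))) ((p₀, σ), 1) *
              (contr ℂ ((hubbardGridSub L M β (2 * (2 * M))).transpose * hubbardCovAboveCT L M β μ 0 0 klE0 *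
                hubbardGridSub L M β (2 * (2 * M))) (((p₀, σ.rev), 0) : GridLeg (GridPoint L (2 * (2 * M)))) ((p₁, σ.rev), 1) *
                contr ℂ ((hubbardGridSub L M β (2 * (2 * M))).transpose * hubbardCovAboveCT L M β μ 0 0 klE0 *
                hubbardGridSub L M β (2 * (2 * M))) (((p₁, σ.rev), 0) : GridLeg (GridPoint L (2 * (2 * M)))) ((p₀, σ.rev), 1))‖
        else 0) ≤
      (16 * ((1 / β) * ∑ i : MatsubaraIdx M, Φ i)) * (((2 * (2 * M) : ℕ) : ℝ) / β) := by
  classical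
  have hβ₀ : (0 : ℝ) < klBetaMin := by norm_num [klBetaMin]
  have hβpos : 0 < β := lt_of_lt_of_le hβ₀ hβ
  have hMpos : 0 < M := Nat.pos_of_ne_zero (NeZero.ne M)
  have hN : 0 < 2 * (2 * M) := by positivity
  have hNr : (0 : ℝ) < ((2 * (2 * M) : ℕ) : ℝ) := by exact_mod_cast hN
  set Cg := (hubbardGridSub L M β (2 * (2 * M))).transpose * hubbardCovAboveCT L M β μ 0 0 klE0 * hubbardGridSub L M β (2 * (2 * M)) with hCg
  -- torus Fourier inverse of the symbol at frequency `i`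
  set T : MatsubaraIdx M → TorusSite 2 L → ℂ := fun i u => torusFourierInv (fun kv : TorusSite 2 L =>
      (fun y : Momentum => uvSymbolFn 1 klE0 (frameLevel μ 0 ((2 * π) • y)) (matsubaraFreq β M i))
        (WithLp.toLp 2 fun j => ((kv j).val : ℝ) / L)) u with hT
  -- weight with the far indicator, as a function of the torus difference
  set W : TorusSite 2 L → ℝ := fun u => if u ≠ 0 ∧ (fun j => (u j).valMinAbs : Site 2) ∉ c.disk then
      Real.sqrt ((((u 0).valMinAbs.natAbs : ℝ)) ^ 2 + (((u 1).valMinAbs.natAbs : ℝ)) ^ 2) ^ (k : ℕ) else 0 with hW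
  have hW0 : ∀ u, 0 ≤ W u := fun u => by simp only [hW]; split_ifs <;> positivity
  have hΦ' : ∀ i, ∑ u : TorusSite 2 L, W u * ‖T i u‖ ^ 2 ≤ Φ i := by
    intro i
    refine le_of_eq_of_le (Finset.sum_congr rfl fun u _ => ?_) (hΦ i)
    simp only [hW, hT]
    split_ifs <;> simp
  -- Gram 16
  have hGB := isGramBoundedR_scaleZero_free_sharp_klEngL₃ (L := L) (M := M) hμ hβ hL
  have h16 : Real.sqrt (2 * (7 + 1)) ^ 2 = 16 := by rw [Real.sq_sqrt (by norm_num)]; norm_num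
  have hA16 : ∀ X Y : GridLeg (GridPoint L (2 * (2 * M))), ‖Cg X Y‖ ≤ 16 := fun X Y => by
    rw [← norm_contr_gridCov_hubbardCovAboveCT β μ klE0 0 (2 * (2 * M)) X Y, contr_apply, ← h16]
    exact IsGramBoundedR.norm_pairing_le hGB X Y
  -- Step 1: sites outside, times inside; per site the time-ℓ² identity
  rw [Fintype.sum_prod_type, Finset.sum_comm]
  have hsite : ∀ x : TorusSite 2 L,
      ∑ j₁ : Fin (2 * (2 * M)), (if ((j₁, x) : GridPoint L (2 * (2 * M))).2 ≠ p₀.2 ∧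
          (fun j => ((((j₁, x) : GridPoint L (2 * (2 * M))).2 - p₀.2) j).valMinAbs : Site 2) ∉ c.disk then
        Real.sqrt ((((((j₁, x) : GridPoint L (2 * (2 * M))).2 - p₀.2) 0).valMinAbs.natAbs : ℝ) ^ 2 +
            (((((j₁, x) : GridPoint L (2 * (2 * M))).2 - p₀.2) 1).valMinAbs.natAbs : ℝ) ^ 2) ^ (k : ℕ) *
          ‖contr ℂ Cg ((((j₁, x), σ), 0) : GridLeg (GridPoint L (2 * (2 * M)))) ((p₀, σ), 1) *
              (contr ℂ Cg (((p₀, σ.rev), 0) : GridLeg (GridPoint L (2 * (2 * M)))) (((j₁, x), σ.rev), 1) *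
                contr ℂ Cg ((((j₁, x), σ.rev), 0) : GridLeg (GridPoint L (2 * (2 * M)))) ((p₀, σ.rev), 1))‖
        else 0) ≤
      W (x - p₀.2) * (16 * (((2 * (2 * M) : ℕ) : ℝ) * ∑ i : MatsubaraIdx M, ‖((1 / β : ℝ) : ℂ) * T i (x - p₀.2)‖ ^ 2)) := by
    intro x
    have hWx : W (x - p₀.2) = if x ≠ p₀.2 ∧ (fun j => ((x - p₀.2) j).valMinAbs : Site 2) ∉ c.disk then
        Real.sqrt ((((x - p₀.2) 0).valMinAbs.natAbs : ℝ) ^ 2 + (((x - p₀.2) 1).valMinAbs.natAbs : ℝ) ^ 2) ^ (k : ℕ) else 0 := by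
      simp only [hW, sub_ne_zero]
    by_cases hcond : x ≠ p₀.2 ∧ (fun j => ((x - p₀.2) j).valMinAbs : Site 2) ∉ c.disk
    · simp only [hcond, and_self, if_true, ne_eq, not_false_eq_true] at hWx ⊢
      rw [hWx, ← Finset.mul_sum]
      refine mul_le_mul_of_nonneg_left ?_ (by positivity)
      have htriple : ∀ j₁ : Fin (2 * (2 * M)),
          ‖contr ℂ Cg ((((j₁, x), σ), 0) : GridLeg (GridPoint L (2 * (2 * M)))) ((p₀, σ), 1) *
              (contr ℂ Cg (((p₀, σ.rev), 0) : GridLeg (GridPoint L (2 * (2 * M)))) (((j₁, x), σ.rev), 1) *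
                contr ℂ Cg ((((j₁, x), σ.rev), 0) : GridLeg (GridPoint L (2 * (2 * M)))) ((p₀, σ.rev), 1))‖ ≤
            16 * ‖Cg ((((j₁, x), σ), 0) : GridLeg (GridPoint L (2 * (2 * M)))) ((p₀, σ), 1)‖ ^ 2 := by
        intro j₁
        rw [norm_mul, norm_mul, norm_contr_gridCov_hubbardCovAboveCT, norm_contr_gridCov_hubbardCovAboveCT, norm_contr_gridCov_hubbardCovAboveCT,
          hCg, ← gridCov_apply_spin_eq hβpos μ klE0 ((j₁, x) : GridPoint L (2 * (2 * M))) p₀ σ σ.rev]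
        have h2 := hA16 ((p₀, σ.rev), 0) (((j₁, x), σ.rev), 1)
        have hn1 := norm_nonneg (Cg ((((j₁, x), σ), 0) : GridLeg (GridPoint L (2 * (2 * M)))) ((p₀, σ), 1))
        rw [hCg] at h2 hn1
        nlinarith
      calc ∑ j₁ : Fin (2 * (2 * M)), ‖contr ℂ Cg ((((j₁, x), σ), 0) : GridLeg (GridPoint L (2 * (2 * M)))) ((p₀, σ), 1) *
              (contr ℂ Cg (((p₀, σ.rev), 0) : GridLeg (GridPoint L (2 * (2 * M)))) (((j₁, x), σ.rev), 1) *
                contr ℂ Cg ((((j₁, x), σ.rev), 0) : GridLeg (GridPoint L (2 * (2 * M)))) ((p₀, σ.rev), 1))‖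
          ≤ ∑ j₁ : Fin (2 * (2 * M)), 16 * ‖Cg ((((j₁, x), σ), 0) : GridLeg (GridPoint L (2 * (2 * M)))) ((p₀, σ), 1)‖ ^ 2 :=
            Finset.sum_le_sum fun j₁ _ => htriple j₁
        _ = 16 * (((2 * (2 * M) : ℕ) : ℝ) * ∑ i : MatsubaraIdx M, ‖((1 / β : ℝ) : ℂ) * T i (x - p₀.2)‖ ^ 2) := by
            rw [← Finset.mul_sum, hCg, sum_normSq_gridCov_eq_of_torusFourierInv hβpos μ p₀ x σ]
    · have hz : W (x - p₀.2) = 0 := by rw [hWx]; exact if_neg hcond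
      simp only [hcond, if_false, Finset.sum_const_zero, hz, zero_mul, le_refl]
  refine (Finset.sum_le_sum fun x _ => hsite x).trans ?_
  -- Step 2: re-index `x ↦ u = x − x₀` and swap the sums
  have hre : ∑ x : TorusSite 2 L, W (x - p₀.2) * (16 * (((2 * (2 * M) : ℕ) : ℝ) * ∑ i : MatsubaraIdx M, ‖((1 / β : ℝ) : ℂ) * T i (x - p₀.2)‖ ^ 2)) =
      ∑ u : TorusSite 2 L, W u * (16 * (((2 * (2 * M) : ℕ) : ℝ) * ∑ i : MatsubaraIdx M, ‖((1 / β : ℝ) : ℂ) * T i u‖ ^ 2)) :=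
    Fintype.sum_equiv (Equiv.subRight p₀.2) _ _ fun x => rfl
  rw [hre]
  have hnormc : ∀ (i : MatsubaraIdx M) (u : TorusSite 2 L), ‖((1 / β : ℝ) : ℂ) * T i u‖ ^ 2 = (1 / β) ^ 2 * ‖T i u‖ ^ 2 := by
    intro i u
    rw [norm_mul, Complex.norm_real, Real.norm_of_nonneg (by positivity), mul_pow]
  simp_rw [hnormc]
  calc ∑ u : TorusSite 2 L, W u * (16 * (((2 * (2 * M) : ℕ) : ℝ) * ∑ i : MatsubaraIdx M, (1 / β) ^ 2 * ‖T i u‖ ^ 2))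
      = 16 * ((2 * (2 * M) : ℕ) : ℝ) * (1 / β) ^ 2 * ∑ i : MatsubaraIdx M, ∑ u : TorusSite 2 L, W u * ‖T i u‖ ^ 2 := by
        rw [Finset.sum_comm]
        simp only [Finset.mul_sum]
        refine Finset.sum_congr rfl fun u _ => Finset.sum_congr rfl fun i _ => ?_
        ring
    _ ≤ 16 * ((2 * (2 * M) : ℕ) : ℝ) * (1 / β) ^ 2 * ∑ i : MatsubaraIdx M, Φ i :=
        mul_le_mul_of_nonneg_left (Finset.sum_le_sum fun i _ => hΦ' i) (by positivity)
    _ = (16 * ((1 / β) * ∑ i : MatsubaraIdx M, Φ i)) * (((2 * (2 * M) : ℕ) : ℝ) / β) := by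
        field_simp

end Summit.HubbardSuperconductivity.HubbardSuperconductivity.Theorems.KLRegimeSplit

end
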